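import Summits.KontsevichZagierPeriods.KontsevichZagierPeriods.Theorems.LinRedNormalFormArrangementNormalFormSeparateTwoComparison

/-!
# Fibre masses at nearby generic base points are comparable

(Line `janus-bands`, crux `ArrangementNormalForm`, stub `stub_separateTwo`, part `Generic`.)
First USE of the comparison toolkit: if two atom valuations `α, α'` have the same coincidence
pattern on the atoms in use (`α c = α c' → α' c = α' c'`), distinct `α`-values are `g`-separated
and `|α' − α| ≤ g/16`, then `mass(α') ≤ 3^{k·#U} · mass(α)` (`lmass_perturb`, registered as
`separateTwo_generic`). Proof: move the value clusters one at a time by LOCAL SHIFTS (part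
`Shift`, consumed here abstractly through the hypothesis `hshift`, which `separateTwo_shift`
discharges with `ℓ = g/8`, `ρ = g/4`) and apply the comparison lemma `SepTwo.lmass_comp_le`
with constant `3` at each step; `lmass_congr` (the mass only sees the atoms in use) glues the
steps. In the crux this is the comparison of the fibre mass at two nearby base points off the
atom-coincidence lines: near such a point the fibre mass is essentially constant, hence locally
integrable as soon as it is finite somewhere — the generic case of the base-dimension-`2`
fibre-mass theorem behind `stub_separateTwo`.
-/

noncomputable section

open Set MeasureTheory
open scoped ENNReal

namespace Summit.KontsevichZagierPeriods.ArrangementNormalForm.JanusBands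

namespace SepTwo

variable {k : ℕ} {ι : Type*}

/-- The fibre mass only depends on the values of the atoms in use. -/
theorem lmass_congr (lo hi : Fin k → Fin k ⊕ ι) (a : Fin k → Option ι) {α β : ι → ℝ}
    (hlo : ∀ i c, lo i = Sum.inr c → α c = β c) (hhi : ∀ i c, hi i = Sum.inr c → α c = β c)
    (ha : ∀ i c, a i = some c → α c = β c) : lmass lo hi a α = lmass lo hi a β := by
  have hcell : cell lo hi α = cell lo hi β := by
    ext t
    simp only [cell, mem_setOf_eq]
    refine forall_congr' fun i => ?_
    have h1 : Sum.elim t α (lo i) = Sum.elim t β (lo i) := by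
      rcases hl : lo i with j | c
      · rfl
      · exact hlo i c hl
    have h2 : Sum.elim t α (hi i) = Sum.elim t β (hi i) := by
      rcases hh : hi i with j | c
      · rfl
      · exact hhi i c hh
    rw [h1, h2]
  have hblock : ∀ t, lblock a α t = lblock a β t := fun t => by
    unfold lblock
    refine Finset.prod_congr rfl fun i _ => ?_
    rcases hai : a i with _ | c
    · rfl
    · simp [ha i c hai]
  unfold lmass
  rw [hcell]
  exact lintegral_congr fun t => hblock t

/-- **Perturbation lemma.** See the module docstring. -/
theorem lmass_perturb (lo hi : Fin k → Fin k ⊕ ι) (a : Fin k → Option ι) (U : Finset ι)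
    (hlo : ∀ i c, lo i = Sum.inr c → c ∈ U) (hhi : ∀ i c, hi i = Sum.inr c → c ∈ U)
    (ha : ∀ i c, a i = some c → c ∈ U) (α α' : ι → ℝ) (g : ℝ)
    (hsep : ∀ c ∈ U, ∀ c' ∈ U, α c ≠ α c' → g ≤ |α c - α c'|)
    (hsmall : ∀ c ∈ U, |α' c - α c| ≤ g / 16)
    (hcoh : ∀ c ∈ U, ∀ c' ∈ U, α c = α c' → α' c = α' c')
    (hshift : ∀ m δ : ℝ, |δ| ≤ g / 16 → ∃ (ψ ψ' : ℝ → ℝ) (B : Finset ℝ), StrictMono ψ ∧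
      Function.Surjective ψ ∧ (∀ x, x ∉ (B : Set ℝ) → HasDerivAt ψ (ψ' x) x) ∧
      (∀ x, 0 ≤ ψ' x ∧ ψ' x ≤ 3) ∧ (∀ x γ, ψ' x * |x - γ| ≤ 3 * |ψ x - ψ γ|) ∧
      (∀ x, |x - m| ≤ g / 8 → ψ x = x + δ) ∧ (∀ x, g / 4 ≤ |x - m| → ψ x = x)) :
    lmass lo hi a α' ≤ ENNReal.ofReal 3 ^ (k * U.card) * lmass lo hi a α := by
  classical
  set V := U.image α with hV
  let β : Finset ℝ → ι → ℝ := fun T c => if α c ∈ T then α' c else α c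
  have hβ : ∀ T c, β T c = if α c ∈ T then α' c else α c := fun T c => rfl
  -- induction over the set of already shifted values
  have hP : ∀ T : Finset ℝ, T ⊆ V →
      lmass lo hi a (β T) ≤ ENNReal.ofReal 3 ^ (k * T.card) * lmass lo hi a α := by
    intro T
    induction T using Finset.induction_on with
    | empty =>
      intro _
      have : β ∅ = α := funext fun c => by simp [hβ]
      rw [this]; simp
    | insert v T hv ih =>
      intro hsub
      have hvV : v ∈ V := hsub (Finset.mem_insert_self v T)
      obtain ⟨c₀, hc₀U, hc₀⟩ := Finset.mem_image.1 hvV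
      set δ := α' c₀ - v with hδ
      have hδs : |δ| ≤ g / 16 := by rw [hδ, ← hc₀]; exact hsmall c₀ hc₀U
      obtain ⟨ψ, ψ', B, hmono, hsurj, hder, hbd, hrat, hcore, hfar⟩ := hshift v δ hδs
      have hg : 0 ≤ g := by linarith [abs_nonneg δ]
      -- the new valuation is the shifted old one on the atoms in use
      have hagree : ∀ c ∈ U, (ψ ∘ β T) c = β (insert v T) c := by
        intro c hcU
        simp only [Function.comp_apply, hβ, Finset.mem_insert]
        by_cases h1 : α c = v
        · have hT : α c ∉ T := h1 ▸ hv
          rw [if_neg hT, if_pos (Or.inl h1), h1, hcore v (by simp; linarith), hδ]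
          have := hcoh c₀ hc₀U c hcU (hc₀.trans h1.symm)
          linarith
        · have hsep' : g ≤ |α c - v| := hc₀ ▸ hsep c hcU c₀ hc₀U (hc₀.symm ▸ h1)
          by_cases h2 : α c ∈ T
          · rw [if_pos h2, if_pos (Or.inr h2)]
            refine hfar _ ?_
            have h3 := hsmall c hcU
            have h4 := abs_sub_abs_le_abs_sub (α c - v) (α c - α' c)
            rw [show α c - v - (α c - α' c) = α' c - v by ring, abs_sub_comm (α c) (α' c)] at h4
            linarith
          · rw [if_neg h2, if_neg (by push Not; exact ⟨h1, h2⟩)]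
            exact hfar _ (by linarith)
      have hcongr : lmass lo hi a (β (insert v T)) = lmass lo hi a (ψ ∘ β T) :=
        lmass_congr lo hi a (fun i c h => (hagree c (hlo i c h)).symm)
          (fun i c h => (hagree c (hhi i c h)).symm) (fun i c h => (hagree c (ha i c h)).symm)
      have hstep := lmass_comp_le lo hi a (β T) B (show (0 : ℝ) ≤ 3 by norm_num) hmono hsurj hder
        (fun x _ => (hbd x).1) (fun x _ => (hbd x).2) (fun x _ i c _ => hrat x (β T c))
      have ih' := ih ((Finset.subset_insert v T).trans hsub)
      rw [hcongr, Finset.card_insert_of_notMem hv, Nat.mul_succ, pow_add]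
      calc lmass lo hi a (ψ ∘ β T) ≤ ENNReal.ofReal 3 ^ k * lmass lo hi a (β T) := hstep
        _ ≤ ENNReal.ofReal 3 ^ k * (ENNReal.ofReal 3 ^ (k * T.card) * lmass lo hi a α) :=
            mul_le_mul_right ih' _
        _ = ENNReal.ofReal 3 ^ (k * T.card) * ENNReal.ofReal 3 ^ k * lmass lo hi a α := by ring
  -- the fully shifted valuation is `α'` on the atoms in use
  have hfin : lmass lo hi a α' = lmass lo hi a (β V) := by
    have hag : ∀ c ∈ U, α' c = β V c := fun c hc => by
      rw [hβ, if_pos (Finset.mem_image_of_mem α hc)]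
    exact lmass_congr lo hi a (fun i c h => hag c (hlo i c h)) (fun i c h => hag c (hhi i c h))
      (fun i c h => hag c (ha i c h))
  have hcard : k * V.card ≤ k * U.card := Nat.mul_le_mul_left k Finset.card_image_le
  have h3 : (1 : ℝ≥0∞) ≤ ENNReal.ofReal 3 := by rw [← ENNReal.ofReal_one]; exact ENNReal.ofReal_le_ofReal (by norm_num)
  rw [hfin]
  exact (hP V subset_rfl).trans (mul_le_mul_left (pow_le_pow_right₀ h3 hcard) _)

end SepTwo

/-- **Fibre masses at nearby generic base points are comparable** (registered sub-goal of
`stub_separateTwo`; literal form of `SepTwo.lmass_perturb`): same coincidence pattern,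
`g`-separated distinct values and a perturbation `≤ g/16` cost at most the factor `3^{k·#U}`,
given local shifts of the fibre line (hypothesis `hshift`, discharged by `separateTwo_shift`). -/
theorem separateTwo_generic (k : ℕ) (ι : Type) (lo hi : Fin k → Fin k ⊕ ι) (a : Fin k → Option ι) (U : Finset ι) (hlo : ∀ i c, lo i = Sum.inr c → c ∈ U) (hhi : ∀ i c, hi i = Sum.inr c → c ∈ U) (ha : ∀ i c, a i = some c → c ∈ U) (α α' : ι → ℝ) (g : ℝ) (hsep : ∀ c ∈ U, ∀ c' ∈ U, α c ≠ α c' → g ≤ |α c - α c'|) (hsmall : ∀ c ∈ U, |α' c - α c| ≤ g / 16) (hcoh : ∀ c ∈ U, ∀ c' ∈ U, α c = α c' → α' c = α' c') (hshift : ∀ m δ : ℝ, |δ| ≤ g / 16 → ∃ (ψ ψ' : ℝ → ℝ) (B : Finset ℝ), StrictMono ψ ∧ Function.Surjective ψ ∧ (∀ x, x ∉ (B : Set ℝ) → HasDerivAt ψ (ψ' x) x) ∧ (∀ x, 0 ≤ ψ' x ∧ ψ' x ≤ 3) ∧ (∀ x γ, ψ' x * |x - γ| ≤ 3 * |ψ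 x - ψ γ|) ∧ (∀ x, |x - m| ≤ g / 8 → ψ x = x + δ) ∧ (∀ x, g / 4 ≤ |x - m| → ψ x = x)) : MeasureTheory.lintegral (MeasureTheory.volume.restrict {t : Fin k → ℝ | ∀ i, Sum.elim t α' (lo i) < t i ∧ t i < Sum.elim t α' (hi i)}) (fun t => ∏ i, (a i).elim 1 (fun c => ENNReal.ofReal |t i - α' c|⁻¹)) ≤ ENNReal.ofReal 3 ^ (k * U.card) * MeasureTheory.lintegral (MeasureTheory.volume.restrict {t : Fin k → ℝ | ∀ i, Sum.elim t α (lo i) < t i ∧ t i < Sum.elim t α (hi i)}) (fun t => ∏ i, (a i).elim 1 (fun c => ENNReal.ofReal |t i - α c|⁻¹)) := by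
  exact SepTwo.lmass_perturb lo hi a U hlo hhi ha α α' g hsep hsmall hcoh hshift

end Summit.KontsevichZagierPeriods.ArrangementNormalForm.JanusBands
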